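import Mathlib
import Literature.Analysis.FluidPDE.BKMClassGradientContinuity
import Literature.Analysis.FluidPDE.BKMClassEnstrophyContinuity
import Literature.Analysis.FluidPDE.FiniteEnergyClassicalHeatLowPass
import Literature.Analysis.FluidPDE.TaoEnstrophyLocalisation
import Literature.Analysis.FluidPDE.TaoLocalisationHolds
import Literature.Analysis.FluidPDE.NSSerrinRegularityProofs
import Summits.NavierStokesRegularity.NavierStokesRegularity.Theorems.StretchingWellBindingEnstrophyQuarterLawEnstrophyScaleCount
import HarnessLib

/-!
# Shelf crux `EnstrophyQuarterLaw` (stmt-NavierStokesRegularity-1574), line «sparse_sieve»: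
# SWARMS ARE SHORT-LIVED — the times at which stub S2 fails with `N` balls at scale `r` have measure
# `≤ C₁ r E₀ / (ν ε₀² N^{1/3})` (unconditional, every first blow-up)

Helper file (`--supports stmt-NavierStokesRegularity-1574 --as helper`) for the OPEN registered stub
`stub_uniformSparseness` (S2), sequel to `…EnstrophyScale` (p817863) and `…EnstrophyScaleCount` (enstrophy count
`card F ≤ C₀ (r Z(t))³/ε₀⁶`). The first DYNAMIC input of the series — the Leray energy inequality
`ν ∫₀ᵀ Z(t) dt ≤ E₀ = ½ ∫ |u₀|²` — turns the pointwise count into a bound on the TIME SET of swarms: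

* `setLIntegral_enstrophy_le` — `∫_{(0,T')} Z(t) dt ≤ E₀/ν` for every `T' < T` (energy equality on the closed
  sub-slab, tree theorem `EnergyDecay.energy_facts`, and the slice identity `∫ |∇u(t)|²_F = Z(t)`);
* `enstrophy_ge_of_swarm` — a swarm of `N ≥ 1` separated `ε₀`-balls at scale `r` at time `t` forces
  `Z(t) ≥ (N/C₀)^{1/3} ε₀² / r`;
* `volume_swarmTimes_le` — **there is an absolute `C₁` such that for every first blow-up, every `ε₀ > 0`, `r > 0`,
  `N ≥ 1` and `T' < T`, the set of times `t ∈ (0, T')` at which some `4r`-separated family of `≥ N` centres has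
  all its balls `B(x,2r)` carrying `∫ |u(t)|³ ≥ ε₀³` has Lebesgue (outer) measure
  `≤ C₁ · r · E₀ / (ν ε₀² N^{1/3})`** (Markov on `∫ Z ≤ E₀/ν`). The bound is uniform in `T'`.

READING (census currency). S2 asks for a count `N₀(ε₀)` valid at EVERY time; unconditionally the exceptional
times where more than `N₀` balls concentrate at scale `r` form a set of measure `O(r / N₀^{1/3})`, which
vanishes as `r → 0` — but slower than the parabolic clock `r²` of scale `r`, which is the gap any proof of S2
must close (on a window of length `r²` before `T` the bound allows swarms all the time). HONEST FRAMING: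
unconditional, energy-level bookkeeping along a HYPOTHETICAL blow-up; S2, the crux `EnstrophyQuarterLaw`
(1574) and Navier–Stokes regularity stay OPEN; no summit statement is proved.
-/

noncomputable section

-- the summit and its single sub-problem share the name (CONVENTIONS §1), as in every Theorems file
set_option linter.dupNamespace false

namespace Summit.NavierStokesRegularity.NavierStokesRegularity.Theorems.EnstrophyQuarterLaw.EnstrophyScale

open MeasureTheory Set Metric Module
open Literature.Analysis Literature.Analysis.FluidPDE
open scoped ENNReal NNReal

variable {ν T : ℝ} {u : ℝ → EuclideanSpace ℝ (Fin 3) → EuclideanSpace ℝ (Fin 3)}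
  {p : ℝ → EuclideanSpace ℝ (Fin 3) → ℝ}

/-! ### The energy inequality in enstrophy form -/

/-- **`∫_{(0,T')} Z(t) dt ≤ E₀/ν` for every `T' < T`** along a classical solution on `[0,T)` that is Leray–Hopf
from a rapidly decaying datum (`Z(t) = ∫ |curl u(t)|²`, `E₀ = ½∫|u₀|²`): the energy equality on the closed slab
`[0,T']` (`EnergyDecay.energy_facts`) and the slice identity `∫ |∇u(t)|²_F = Z(t)` for divergence-free decaying
slices. [cite: Leray1934, §17 (3.4)] -/
theorem setLIntegral_enstrophy_le (hν : 0 < ν) (hcl : IsClassicalNSSolutionOn (Ico 0 T) ν 0 u p)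
    (hLH : IsLerayHopfOn T ν 0 (u 0) u) (hdec : HasRapidSpatialDecay (u 0)) {T' : ℝ} (hT' : 0 < T')
    (hT'T : T' < T) :
    ∫⁻ t in Ioo 0 T', ∫⁻ y, ‖curl (u t) y‖ₑ ^ 2 ≤
      ENNReal.ofReal (VectorCalculus.kineticEnergy (u 0) / ν) := by
  have hcl₁ : IsClassicalNSSolutionOn (Icc 0 T') ν 0 u p :=
    hcl.mono (fun s hs => ⟨hs.1, lt_of_le_of_lt hs.2 hT'T⟩) (uniqueDiffOn_Icc hT')
  have hfe : ∃ A : ℝ≥0∞, A < ⊤ ∧ ∀ t ∈ Icc 0 T', ∫⁻ x, ‖u t x‖ₑ ^ 2 ≤ A :=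
    ⟨ENNReal.ofReal (2 * VectorCalculus.kineticEnergy (u 0)), ENNReal.ofReal_lt_top, fun s hs =>
      hLH.eEnergy_le_datum hν.le (t := s) ⟨hs.1, hs.2.trans hT'T.le⟩⟩
  obtain ⟨-, hDtop, hD⟩ := EnergyDecay.energy_facts hcl₁ hν hT' hfe
  -- slice identity on `(0, T')`
  have hslice : EqOn (fun t => ∫⁻ y, ‖curl (u t) y‖ₑ ^ 2)
      (fun t => ∫⁻ y, ENNReal.ofReal (frobeniusNormSq (fderiv ℝ (u t) y))) (Ioo 0 T') := by
    intro t ht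
    have htI : t ∈ Ico 0 T := ⟨ht.1.le, ht.2.trans hT'T⟩
    have hn := lintegral_iteratedFDeriv_sq_lt_top hν hcl hLH hdec htI
    have hv : ContDiff ℝ 2 (u t) := (hcl.contDiff_velocity htI).of_le (by norm_cast)
    have h0 : ∫⁻ y, ‖u t y‖ₑ ^ 2 < ⊤ := by
      refine lt_of_le_of_lt (le_of_eq (lintegral_congr fun y => ?_)) (hn 0)
      rw [← ofReal_norm, ← norm_iteratedFDeriv_zero (𝕜 := ℝ) (f := u t), ofReal_norm]
    exact (lintegral_frobeniusNormSq_fderiv_eq_lintegral_curl_sq hv (hcl.divFree t htI) h0 (hn 1) (hn 2)).symm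
  rw [setLIntegral_congr_fun measurableSet_Ioo hslice,
    ← ENNReal.ofReal_toReal hDtop]
  refine ENNReal.ofReal_le_ofReal ?_
  rw [le_div_iff₀ hν, mul_comm]
  exact hD

/-! ### A swarm forces large enstrophy -/

/-- **A swarm forces large enstrophy.** With the absolute `C₀` of `card_le_enstrophy_count`: if at time
`t ∈ [0,T)` some `4r`-separated family of `N ≥ 1` centres has every ball `B(x,2r)` carrying `∫ |u(t)|³ ≥ ε₀³`,
then `Z(t) ≥ (N/C₀)^{1/3} ε₀² / r`. [folklore] -/
theorem enstrophy_ge_of_swarm :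
    ∃ C₀ : ℝ, 0 < C₀ ∧ ∀ (ν T : ℝ), 0 < ν → 0 < T →
      ∀ (u : ℝ → EuclideanSpace ℝ (Fin 3) → EuclideanSpace ℝ (Fin 3))
        (p : ℝ → EuclideanSpace ℝ (Fin 3) → ℝ),
      IsMaximalSmoothSolution ν 0 u p T → IsLerayHopfOn T ν 0 (u 0) u →
      HasRapidSpatialDecay (u 0) →
      ∀ ε₀ : ℝ, 0 < ε₀ → ∀ t ∈ Set.Ico 0 T, ∀ r : ℝ, 0 < r → ∀ N : ℕ, 1 ≤ N →
        (∃ F : Finset (EuclideanSpace ℝ (Fin 3)),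
          (∀ x ∈ F, ∀ y ∈ F, x ≠ y → 4 * r ≤ dist x y) ∧
          (∀ x ∈ F, ENNReal.ofReal (ε₀ ^ 3) ≤ ∫⁻ y in Metric.ball x (2 * r), ‖u t y‖ₑ ^ 3) ∧
          N ≤ F.card) →
        ENNReal.ofReal (((N : ℝ) / C₀) ^ (1 / 3 : ℝ) * ε₀ ^ 2 / r) ≤ ∫⁻ y, ‖curl (u t) y‖ₑ ^ 2 := by
  obtain ⟨C₀, hC₀, hcount⟩ := card_le_enstrophy_count
  refine ⟨C₀, hC₀, fun ν T hν hT u p hmax hLH hdec ε₀ hε₀ t ht r hr N hN ⟨F, hsep, hconc, hNF⟩ => ?_⟩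
  set Z : ℝ≥0∞ := ∫⁻ y, ‖curl (u t) y‖ₑ ^ 2 with hZ
  have hn := lintegral_iteratedFDeriv_sq_lt_top hν hmax.1 hLH hdec ht
  have hZtop : Z ≠ ⊤ :=
    (lt_of_le_of_lt (lintegral_curl_sq_le (u t)) (ENNReal.mul_lt_top ENNReal.ofReal_lt_top (hn 1))).ne
  have hc := hcount ν T hν hT u p hmax hLH hdec ε₀ hε₀ t ht r hr F hsep hconc
  -- `N ε₀⁶ / C₀ ≤ (r Z)³`
  have hZr : 0 ≤ Z.toReal := ENNReal.toReal_nonneg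
  have h1 : (N : ℝ) * ε₀ ^ 6 / C₀ ≤ (r * Z.toReal) ^ 3 := by
    rw [div_le_iff₀ hC₀]
    have := (Nat.cast_le.2 hNF).trans hc
    rw [le_div_iff₀ (by positivity)] at this
    linarith
  -- cube roots
  have e3 : (1 / 3 : ℝ) = ((3 : ℕ) : ℝ)⁻¹ := by norm_num
  have h2 : ((N : ℝ) / C₀) ^ (1 / 3 : ℝ) * ε₀ ^ 2 ≤ r * Z.toReal := by
    have h := Real.rpow_le_rpow (by positivity) h1 (by norm_num : (0 : ℝ) ≤ 1 / 3)
    rw [e3, Real.pow_rpow_inv_natCast (by positivity) (by norm_num : (3 : ℕ) ≠ 0)] at h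
    refine le_trans (le_of_eq ?_) h
    rw [show (N : ℝ) * ε₀ ^ 6 / C₀ = (N : ℝ) / C₀ * (ε₀ ^ 2) ^ (3 : ℕ) by ring,
      Real.mul_rpow (by positivity) (by positivity),
      Real.pow_rpow_inv_natCast (by positivity) (by norm_num : (3 : ℕ) ≠ 0), ← e3]
  rw [← ENNReal.ofReal_toReal hZtop]
  refine ENNReal.ofReal_le_ofReal ?_
  rw [div_le_iff₀ hr]
  linarith

/-! ### Markov: the swarm times are a small set -/

/-- **SWARMS ARE SHORT-LIVED (unconditional).** There is an absolute `C₁ > 0` such that for every `ν, T > 0`,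
every maximal classical solution `u` on `[0,T)` that is Leray–Hopf from its rapidly decaying datum, every
`ε₀ > 0`, `r > 0`, `N ≥ 1` and `0 < T' < T`: the set of times `t ∈ (0,T')` at which some `4r`-separated finite
family of at least `N` centres has all its balls `B(x, 2r)` carrying `∫ |u(t)|³ ≥ ε₀³` (a swarm violating the
S2 count `N − 1`) has measure `≤ C₁ · r · E₀ / (ν ε₀² N^{1/3})`, `E₀ = ½ ∫ |u₀|²` — uniformly in `T'`.
(`enstrophy_ge_of_swarm` + Markov on `setLIntegral_enstrophy_le`; `C₁ = C₀^{1/3}`.) [folklore] -/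
theorem volume_swarmTimes_le :
    ∃ C₁ : ℝ, 0 < C₁ ∧ ∀ (ν T : ℝ), 0 < ν → 0 < T →
      ∀ (u : ℝ → EuclideanSpace ℝ (Fin 3) → EuclideanSpace ℝ (Fin 3))
        (p : ℝ → EuclideanSpace ℝ (Fin 3) → ℝ),
      IsMaximalSmoothSolution ν 0 u p T → IsLerayHopfOn T ν 0 (u 0) u →
      HasRapidSpatialDecay (u 0) →
      ∀ ε₀ : ℝ, 0 < ε₀ → ∀ r : ℝ, 0 < r → ∀ N : ℕ, 1 ≤ N → ∀ T' : ℝ, 0 < T' → T' < T →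
        volume {t ∈ Set.Ioo 0 T' | ∃ F : Finset (EuclideanSpace ℝ (Fin 3)),
          (∀ x ∈ F, ∀ y ∈ F, x ≠ y → 4 * r ≤ dist x y) ∧
          (∀ x ∈ F, ENNReal.ofReal (ε₀ ^ 3) ≤ ∫⁻ y in Metric.ball x (2 * r), ‖u t y‖ₑ ^ 3) ∧
          N ≤ F.card} ≤
        ENNReal.ofReal (C₁ * r * VectorCalculus.kineticEnergy (u 0) /
          (ν * ε₀ ^ 2 * (N : ℝ) ^ (1 / 3 : ℝ))) := by
  obtain ⟨C₀, hC₀, hsw⟩ := enstrophy_ge_of_swarm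
  refine ⟨C₀ ^ (1 / 3 : ℝ), by positivity, ?_⟩
  intro ν T hν hT u p hmax hLH hdec ε₀ hε₀ r hr N hN T' hT' hT'T
  have hcl : IsClassicalNSSolutionOn (Ico 0 T) ν 0 u p := hmax.1
  set Z : ℝ → ℝ≥0∞ := fun t => ∫⁻ y, ‖curl (u t) y‖ₑ ^ 2 with hZ
  set lam : ℝ := ((N : ℝ) / C₀) ^ (1 / 3 : ℝ) * ε₀ ^ 2 / r with hlam
  have hNpos : (0 : ℝ) < N := by exact_mod_cast hN
  have hlampos : 0 < lam := by rw [hlam]; positivity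
  set μ : Measure ℝ := volume.restrict (Ioo 0 T') with hμ
  -- (i) the swarm times lie in `{λ ≤ Z}`
  have hsub : {t ∈ Set.Ioo 0 T' | ∃ F : Finset (EuclideanSpace ℝ (Fin 3)),
          (∀ x ∈ F, ∀ y ∈ F, x ≠ y → 4 * r ≤ dist x y) ∧
          (∀ x ∈ F, ENNReal.ofReal (ε₀ ^ 3) ≤ ∫⁻ y in Metric.ball x (2 * r), ‖u t y‖ₑ ^ 3) ∧
          N ≤ F.card} ⊆ {t | ENNReal.ofReal lam ≤ Z t} ∩ Ioo 0 T' := by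
    intro t ht
    exact ⟨hsw ν T hν hT u p hmax hLH hdec ε₀ hε₀ t ⟨ht.1.1.le, ht.1.2.trans hT'T⟩ r hr N hN ht.2, ht.1⟩
  -- (ii) `Z` is a.e.-measurable on `(0, T')` (it is continuous on `[0, T)`)
  have hreg : ∀ T'' < T, HasBoundedSobolevNormsOn (Icc 0 T'') u := by
    intro T'' hT''
    by_cases hpos : 0 < T''
    · have hcl₁ : IsClassicalNSSolutionOn (Icc 0 T'') ν 0 u p :=
        hcl.mono (fun s hs => ⟨hs.1, lt_of_le_of_lt hs.2 hT''⟩) (uniqueDiffOn_Icc hpos)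
      have hfe : ∃ C' : ℝ≥0, ∀ s ∈ Icc 0 T'', ∫⁻ x, ‖u s x‖ₑ ^ 2 ≤ C' := by
        refine ⟨(2 * VectorCalculus.kineticEnergy (u 0)).toNNReal, fun s hs => ?_⟩
        have h := hLH.eEnergy_le_datum hν.le (t := s) ⟨hs.1, hs.2.trans hT''.le⟩
        exact h
      exact tao2011_hasBoundedSobolevNormsOn_holds hν hpos hcl₁ hfe hdec
    · -- degenerate slab `[0, T''] ⊆ {0}`: bounded by the value at `0`
      intro n
      have hn0 := lintegral_iteratedFDeriv_sq_lt_top hν hcl hLH hdec (t := 0) ⟨le_rfl, hT⟩ n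
      refine ⟨(∫⁻ x, ‖iteratedFDeriv ℝ n (u 0) x‖ₑ ^ 2).toNNReal, fun s hs => ?_⟩
      have hs0 : s = 0 := le_antisymm (hs.2.trans (not_lt.1 hpos)) hs.1
      rw [hs0, ENNReal.coe_toNNReal hn0.ne]
  have hcont := hcl.continuousOn_integral_norm_curl_sq_Ico hreg
  have hZeq : ∀ t ∈ Ioo 0 T', Z t = ENNReal.ofReal (∫ x, ‖curl (u t) x‖ ^ 2) := by
    intro t ht
    have htI : t ∈ Ico 0 T := ⟨ht.1.le, ht.2.trans hT'T⟩
    have hv : ContDiff ℝ 2 (u t) := (hcl.contDiff_velocity htI).of_le (by norm_cast)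
    exact lintegral_enorm_curl_sq_eq_ofReal_integral hv (lintegral_iteratedFDeriv_sq_lt_top hν hcl hLH hdec htI 1)
  have hZmeas : AEMeasurable Z μ := by
    have hg : AEMeasurable (fun t => ENNReal.ofReal (∫ x, ‖curl (u t) x‖ ^ 2)) μ :=
      ENNReal.measurable_ofReal.comp_aemeasurable
        ((hcont.mono fun t ht => ⟨ht.1.le, ht.2.trans hT'T⟩).aemeasurable measurableSet_Ioo)
    refine hg.congr ?_
    rw [hμ, Filter.EventuallyEq, ae_restrict_iff' measurableSet_Ioo]
    exact Filter.Eventually.of_forall fun t ht => (hZeq t ht).symm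
  -- (iii) Markov
  have hmarkov := mul_meas_ge_le_lintegral₀ hZmeas (ENNReal.ofReal lam)
  have hint : ∫⁻ t, Z t ∂μ ≤ ENNReal.ofReal (VectorCalculus.kineticEnergy (u 0) / ν) :=
    setLIntegral_enstrophy_le hν hcl hLH hdec hT' hT'T
  have hmeas_le : μ {t | ENNReal.ofReal lam ≤ Z t} ≤
      ENNReal.ofReal (VectorCalculus.kineticEnergy (u 0) / ν) / ENNReal.ofReal lam := by
    rw [ENNReal.le_div_iff_mul_le (Or.inl ((ENNReal.ofReal_pos.2 hlampos).ne'))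
      (Or.inl ENNReal.ofReal_ne_top), mul_comm]
    exact hmarkov.trans hint
  -- (iv) assemble
  have hE0 : 0 ≤ VectorCalculus.kineticEnergy (u 0) := kineticEnergy_nonneg _
  calc volume {t ∈ Set.Ioo 0 T' | ∃ F : Finset (EuclideanSpace ℝ (Fin 3)),
          (∀ x ∈ F, ∀ y ∈ F, x ≠ y → 4 * r ≤ dist x y) ∧
          (∀ x ∈ F, ENNReal.ofReal (ε₀ ^ 3) ≤ ∫⁻ y in Metric.ball x (2 * r), ‖u t y‖ₑ ^ 3) ∧
          N ≤ F.card}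
      ≤ volume ({t | ENNReal.ofReal lam ≤ Z t} ∩ Ioo 0 T') := measure_mono hsub
    _ ≤ μ {t | ENNReal.ofReal lam ≤ Z t} := Measure.le_restrict_apply _ _
    _ ≤ ENNReal.ofReal (VectorCalculus.kineticEnergy (u 0) / ν) / ENNReal.ofReal lam := hmeas_le
    _ = ENNReal.ofReal (VectorCalculus.kineticEnergy (u 0) / ν / lam) :=
        (ENNReal.ofReal_div_of_pos hlampos).symm
    _ = ENNReal.ofReal (C₀ ^ (1 / 3 : ℝ) * r * VectorCalculus.kineticEnergy (u 0) /
          (ν * ε₀ ^ 2 * (N : ℝ) ^ (1 / 3 : ℝ))) := by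
        congr 1
        have hC3 : 0 < C₀ ^ (1 / 3 : ℝ) := by positivity
        have hN3 : 0 < (N : ℝ) ^ (1 / 3 : ℝ) := by positivity
        rw [hlam, Real.div_rpow hNpos.le hC₀.le]
        field_simp

/-! ### APPENDED (same hand): the whole life span `(0, T)` -/

/-- **`∫_{(0,T)} Z(t) dt ≤ E₀/ν` on the WHOLE life span** of a classical solution on `[0,T)` that is Leray–Hopf
from a rapidly decaying datum (`T > 0`): the closed-slab bounds `setLIntegral_enstrophy_le` on `(0, T − T/(n+2))`,
and continuity of the measure `Z · dt` along the increasing union `⋃ₙ (0, T − T/(n+2)) = (0, T)`. In particular the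
total dissipation up to the blow-up time is finite. [cite: Leray1934, §17 (3.4)] -/
theorem setLIntegral_enstrophy_le_lifespan (hν : 0 < ν) (hT : 0 < T)
    (hcl : IsClassicalNSSolutionOn (Ico 0 T) ν 0 u p) (hLH : IsLerayHopfOn T ν 0 (u 0) u)
    (hdec : HasRapidSpatialDecay (u 0)) :
    ∫⁻ t in Ioo 0 T, ∫⁻ y, ‖curl (u t) y‖ₑ ^ 2 ≤
      ENNReal.ofReal (VectorCalculus.kineticEnergy (u 0) / ν) := by
  set Z : ℝ → ℝ≥0∞ := fun t => ∫⁻ y, ‖curl (u t) y‖ₑ ^ 2 with hZ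
  set Tn : ℕ → ℝ := fun n => T - T / ((n : ℝ) + 2) with hTn
  have hTn_pos : ∀ n, 0 < Tn n := fun n => by
    have h2 : (2 : ℝ) ≤ (n : ℝ) + 2 := by linarith [(Nat.cast_nonneg n : (0 : ℝ) ≤ n)]
    have : T / ((n : ℝ) + 2) ≤ T / 2 := div_le_div_of_nonneg_left hT.le (by norm_num) h2
    simp only [hTn]; linarith
  have hTn_lt : ∀ n, Tn n < T := fun n => by
    have : 0 < T / ((n : ℝ) + 2) := by positivity
    simp only [hTn]; linarith
  have hmono : Monotone fun n => Ioo (0 : ℝ) (Tn n) := by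
    intro m n hmn
    refine Ioo_subset_Ioo le_rfl ?_
    simp only [hTn]
    have : T / ((n : ℝ) + 2) ≤ T / ((m : ℝ) + 2) :=
      div_le_div_of_nonneg_left hT.le (by positivity) (by exact_mod_cast Nat.add_le_add_right hmn 2)
    linarith
  have hunion : (⋃ n, Ioo (0 : ℝ) (Tn n)) = Ioo 0 T := by
    refine Subset.antisymm (iUnion_subset fun n => Ioo_subset_Ioo le_rfl (hTn_lt n).le) fun t ht => ?_
    obtain ⟨n, hn⟩ := exists_nat_gt (T / (T - t))
    have hTt : 0 < T - t := by linarith [ht.2]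
    refine mem_iUnion.2 ⟨n, ht.1, ?_⟩
    simp only [hTn]
    have hn2 : T / (T - t) < (n : ℝ) + 2 := by linarith
    have : T / ((n : ℝ) + 2) < T - t := by
      rw [div_lt_iff₀ (by positivity)]
      rw [div_lt_iff₀ hTt] at hn2
      linarith
    linarith
  -- the measure `Z dt`
  have hrepr : ∀ s : Set ℝ, MeasurableSet s → ∫⁻ t in s, Z t = (volume.withDensity Z) s :=
    fun s hs => (withDensity_apply Z hs).symm
  rw [hrepr _ measurableSet_Ioo, ← hunion, hmono.measure_iUnion]
  refine iSup_le fun n => ?_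
  rw [← hrepr _ measurableSet_Ioo]
  exact setLIntegral_enstrophy_le hν hcl hLH hdec (hTn_pos n) (hTn_lt n)

/-- **SWARMS ARE SHORT-LIVED, whole life span.** With the absolute `C₁` of `volume_swarmTimes_le`'s proof
(`C₁ = C₀^{1/3}`): for every maximal classical solution on `[0,T)` that is Leray–Hopf from a rapidly decaying
datum, every `ε₀ > 0`, `r > 0`, `N ≥ 1`, the set of times `t ∈ (0,T)` carrying a `4r`-separated family of `≥ N`
centres whose balls `B(x,2r)` are `ε₀`-concentrating has measure `≤ C₁ r E₀/(ν ε₀² N^{1/3})`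
(`enstrophy_ge_of_swarm` + Markov on `setLIntegral_enstrophy_le_lifespan`). [folklore] -/
theorem volume_swarmTimes_le_lifespan :
    ∃ C₁ : ℝ, 0 < C₁ ∧ ∀ (ν T : ℝ), 0 < ν → 0 < T →
      ∀ (u : ℝ → EuclideanSpace ℝ (Fin 3) → EuclideanSpace ℝ (Fin 3))
        (p : ℝ → EuclideanSpace ℝ (Fin 3) → ℝ),
      IsMaximalSmoothSolution ν 0 u p T → IsLerayHopfOn T ν 0 (u 0) u →
      HasRapidSpatialDecay (u 0) →
      ∀ ε₀ : ℝ, 0 < ε₀ → ∀ r : ℝ, 0 < r → ∀ N : ℕ, 1 ≤ N →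
        volume {t ∈ Set.Ioo 0 T | ∃ F : Finset (EuclideanSpace ℝ (Fin 3)),
          (∀ x ∈ F, ∀ y ∈ F, x ≠ y → 4 * r ≤ dist x y) ∧
          (∀ x ∈ F, ENNReal.ofReal (ε₀ ^ 3) ≤ ∫⁻ y in Metric.ball x (2 * r), ‖u t y‖ₑ ^ 3) ∧
          N ≤ F.card} ≤
        ENNReal.ofReal (C₁ * r * VectorCalculus.kineticEnergy (u 0) /
          (ν * ε₀ ^ 2 * (N : ℝ) ^ (1 / 3 : ℝ))) := by
  obtain ⟨C₀, hC₀, hsw⟩ := enstrophy_ge_of_swarm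
  refine ⟨C₀ ^ (1 / 3 : ℝ), by positivity, ?_⟩
  intro ν T hν hT u p hmax hLH hdec ε₀ hε₀ r hr N hN
  have hcl : IsClassicalNSSolutionOn (Ico 0 T) ν 0 u p := hmax.1
  set Z : ℝ → ℝ≥0∞ := fun t => ∫⁻ y, ‖curl (u t) y‖ₑ ^ 2 with hZ
  set lam : ℝ := ((N : ℝ) / C₀) ^ (1 / 3 : ℝ) * ε₀ ^ 2 / r with hlam
  have hNpos : (0 : ℝ) < N := by exact_mod_cast hN
  have hlampos : 0 < lam := by rw [hlam]; positivity
  set μ : Measure ℝ := volume.restrict (Ioo 0 T) with hμ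
  -- (i) the swarm times lie in `{λ ≤ Z}`
  have hsub : {t ∈ Set.Ioo 0 T | ∃ F : Finset (EuclideanSpace ℝ (Fin 3)),
          (∀ x ∈ F, ∀ y ∈ F, x ≠ y → 4 * r ≤ dist x y) ∧
          (∀ x ∈ F, ENNReal.ofReal (ε₀ ^ 3) ≤ ∫⁻ y in Metric.ball x (2 * r), ‖u t y‖ₑ ^ 3) ∧
          N ≤ F.card} ⊆ {t | ENNReal.ofReal lam ≤ Z t} ∩ Ioo 0 T := by
    intro t ht
    exact ⟨hsw ν T hν hT u p hmax hLH hdec ε₀ hε₀ t ⟨ht.1.1.le, ht.1.2⟩ r hr N hN ht.2, ht.1⟩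
  -- (ii) `Z` is a.e.-measurable on `(0, T)` (continuous on `[0, T)`)
  have hreg : ∀ T'' < T, HasBoundedSobolevNormsOn (Icc 0 T'') u := by
    intro T'' hT''
    by_cases hpos : 0 < T''
    · have hcl₁ : IsClassicalNSSolutionOn (Icc 0 T'') ν 0 u p :=
        hcl.mono (fun s hs => ⟨hs.1, lt_of_le_of_lt hs.2 hT''⟩) (uniqueDiffOn_Icc hpos)
      have hfe : ∃ C' : ℝ≥0, ∀ s ∈ Icc 0 T'', ∫⁻ x, ‖u s x‖ₑ ^ 2 ≤ C' := by
        refine ⟨(2 * VectorCalculus.kineticEnergy (u 0)).toNNReal, fun s hs => ?_⟩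
        have h := hLH.eEnergy_le_datum hν.le (t := s) ⟨hs.1, hs.2.trans hT''.le⟩
        exact h
      exact tao2011_hasBoundedSobolevNormsOn_holds hν hpos hcl₁ hfe hdec
    · intro n
      have hn0 := lintegral_iteratedFDeriv_sq_lt_top hν hcl hLH hdec (t := 0) ⟨le_rfl, hT⟩ n
      refine ⟨(∫⁻ x, ‖iteratedFDeriv ℝ n (u 0) x‖ₑ ^ 2).toNNReal, fun s hs => ?_⟩
      have hs0 : s = 0 := le_antisymm (hs.2.trans (not_lt.1 hpos)) hs.1
      rw [hs0, ENNReal.coe_toNNReal hn0.ne]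
  have hcont := hcl.continuousOn_integral_norm_curl_sq_Ico hreg
  have hZeq : ∀ t ∈ Ioo 0 T, Z t = ENNReal.ofReal (∫ x, ‖curl (u t) x‖ ^ 2) := by
    intro t ht
    have htI : t ∈ Ico 0 T := ⟨ht.1.le, ht.2⟩
    have hv : ContDiff ℝ 2 (u t) := (hcl.contDiff_velocity htI).of_le (by norm_cast)
    exact lintegral_enorm_curl_sq_eq_ofReal_integral hv (lintegral_iteratedFDeriv_sq_lt_top hν hcl hLH hdec htI 1)
  have hZmeas : AEMeasurable Z μ := by
    have hg : AEMeasurable (fun t => ENNReal.ofReal (∫ x, ‖curl (u t) x‖ ^ 2)) μ :=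
      ENNReal.measurable_ofReal.comp_aemeasurable
        ((hcont.mono fun t ht => ⟨ht.1.le, ht.2⟩).aemeasurable measurableSet_Ioo)
    refine hg.congr ?_
    rw [hμ, Filter.EventuallyEq, ae_restrict_iff' measurableSet_Ioo]
    exact Filter.Eventually.of_forall fun t ht => (hZeq t ht).symm
  -- (iii) Markov on the whole life span
  have hmarkov := mul_meas_ge_le_lintegral₀ hZmeas (ENNReal.ofReal lam)
  have hint : ∫⁻ t, Z t ∂μ ≤ ENNReal.ofReal (VectorCalculus.kineticEnergy (u 0) / ν) :=
    setLIntegral_enstrophy_le_lifespan hν hT hcl hLH hdec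
  have hmeas_le : μ {t | ENNReal.ofReal lam ≤ Z t} ≤
      ENNReal.ofReal (VectorCalculus.kineticEnergy (u 0) / ν) / ENNReal.ofReal lam := by
    rw [ENNReal.le_div_iff_mul_le (Or.inl ((ENNReal.ofReal_pos.2 hlampos).ne'))
      (Or.inl ENNReal.ofReal_ne_top), mul_comm]
    exact hmarkov.trans hint
  -- (iv) assemble
  calc volume {t ∈ Set.Ioo 0 T | ∃ F : Finset (EuclideanSpace ℝ (Fin 3)),
          (∀ x ∈ F, ∀ y ∈ F, x ≠ y → 4 * r ≤ dist x y) ∧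
          (∀ x ∈ F, ENNReal.ofReal (ε₀ ^ 3) ≤ ∫⁻ y in Metric.ball x (2 * r), ‖u t y‖ₑ ^ 3) ∧
          N ≤ F.card}
      ≤ volume ({t | ENNReal.ofReal lam ≤ Z t} ∩ Ioo 0 T) := measure_mono hsub
    _ ≤ μ {t | ENNReal.ofReal lam ≤ Z t} := Measure.le_restrict_apply _ _
    _ ≤ ENNReal.ofReal (VectorCalculus.kineticEnergy (u 0) / ν) / ENNReal.ofReal lam := hmeas_le
    _ = ENNReal.ofReal (VectorCalculus.kineticEnergy (u 0) / ν / lam) :=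
        (ENNReal.ofReal_div_of_pos hlampos).symm
    _ = ENNReal.ofReal (C₀ ^ (1 / 3 : ℝ) * r * VectorCalculus.kineticEnergy (u 0) /
          (ν * ε₀ ^ 2 * (N : ℝ) ^ (1 / 3 : ℝ))) := by
        congr 1
        have hC3 : 0 < C₀ ^ (1 / 3 : ℝ) := by positivity
        have hN3 : 0 < (N : ℝ) ^ (1 / 3 : ℝ) := by positivity
        rw [hlam, Real.div_rpow hNpos.le hC₀.le]
        field_simp

end Summit.NavierStokesRegularity.NavierStokesRegularity.Theorems.EnstrophyQuarterLaw.EnstrophyScale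

end
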